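import Summits.Ventures.AbcShadow.SH01.Level972

/-!
# Venture AbcShadow — ROW SH-01: `xⁿ + yⁿ = C z³`, `C ∈ {6, 12, 18, 36}`, every prime `n ≥ 5` (the reduction theorem)

HONEST FRAMING. A row of the work-bound cell `abc-shadow` (typer seat `abc-shadow-typ-1`): a CONDITIONAL,
typed/kernel-checked REDUCTION, no claim on abc or on any summit, no side on IUT. `sh01_of` derives the target `SH01`
(`SH01/Statement.lean`) from EXACTLY these hypotheses on an arbitrary model `M : CMNewformModel` (meaningful for the
intended model only, see `SH01/BVY04Package.lean`):

* `hP : M.BVY04Package` — CITED print package [BVY04, Lemma 3.4 + Cor 3.3 + Prop 4.2 (via the definition p. 1405)];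
* `h43 : M.BVY04Prop43` — CITED [BVY04, Prop 4.3];
* `hJ21 : M.BVY04RankInput21`, `hJ39 : M.BVY04RankInput39` (= `M.J0RankZeroQuotient 21 (-3)` / `39 (-3)`) — the two printed RANK INPUTS of
  [BVY04, p. 1407] ("21A together with its `ℚ(√−3)`-quadratic twist 63A have rank 0 over `ℚ` … `J₀(21)` has a finite
  quotient over `ℚ(√−3)`"; "Applying Proposition 2.1 of Kamienny [Kam90] … `J₀(39)` has a finite quotient over
  `ℚ(√−3)`"), CITED;
* `hD : M.DataComplete 972 level972Orbits` — COMPUTED: the newform data of `S₂^new(Γ₀(972))` transcribed in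
  `SH01/Level972.lean` from the cell's certificate 4a36c28685fe0350 (eng-2 j313661; re-checked crit-1 b04eef01a5a58dab) —
  the ONE computed input that remains a named hypothesis (faithfulness of the transcribed Hecke data to the space);
* `hCM : M.CMBy 972 level972CMOrbits (-3)` — COMPUTED/TABLE: the four rational orbits are CM by `ℚ(√−3)`
  (certificate (R1)+(R2) = Cremona 972A1–D1, `j = 0`).

Everything else is PROVED here, in the kernel: the reduction of an arbitrary non-trivial primitive solution to print's
normal form (`3 ∤ x`, `yⁿ ≢ 2 (mod 3)`, by the symmetry `x ↔ y`), `|xy| > 1`, cube-freeness of `C`, `n ∤ C`, the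
level `N_n(E) = 972` [Cor 3.3 row `3 ∣ C`], the [Prop 4.2] SIEVE for the three non-CM orbits at `q ∈ {5, 7, 11, 13}`
(kernel certificates of `Level972.lean`, allowed sets = union of the two printed shapes), and the case tree of
[Prop 4.3] for the four CM orbits: (a) is void since `2 ∣ C`; (b) needs `n ∈ {5, 7, 13}`: `n = 5` is inert in `ℚ(√−3)`
(`−3` is not a square mod 5, `decide`), `n = 7, 13` are answered by the rank inputs `hJ21`, `hJ39`, and the alternative
`ab = ±2^r 3^s, s > 0` is impossible because `3 ∣ C` and `(xy, Cz) = 1`. In print the statement is [Kra11, Thm 1.1] for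
`n > 6³⁶⁰` only; the words for this row: typed/kernel-checked REDUCTION; the newform data is COMPUTED (certificate
4a36c28685fe0350) and enters as the hypothesis `DataComplete`; print inputs are NAMED hypotheses; adjacent, NOT abc;
no side on IUT. AI-typed; weaker than expert refereeing of the cited inputs.
-/

namespace Summit.Ventures.AbcShadow

open Summit.Ventures.AbcSig (NewformModel FreyDatum OrbitData)

/-- The row's coefficients are cube-free. [folklore] -/
theorem sh01_cubefree : ∀ C ∈ ({6, 12, 18, 36} : Finset ℕ), ∀ q : ℕ, q.Prime → ¬ q ^ 3 ∣ C := by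
  intro C hC q hq h
  simp only [Finset.mem_insert, Finset.mem_singleton] at hC
  have h36 : q ^ 3 ∣ 36 * C := Dvd.dvd.mul_left h 36
  have hq3 : q ∣ C := (dvd_pow_self q (by norm_num)).trans h
  have hqle : q ≤ 36 := by
    rcases hC with rfl | rfl | rfl | rfl <;> exact (Nat.le_of_dvd (by norm_num) hq3).trans (by norm_num)
  rcases hC with rfl | rfl | rfl | rfl <;> interval_cases q <;> revert hq h <;> decide

/-- No prime `n ≥ 5` divides a row coefficient. [folklore] -/
theorem sh01_n_not_dvd (C : ℕ) (hC : C ∈ ({6, 12, 18, 36} : Finset ℕ)) (n : ℕ) (hn : n.Prime) (h5 : 5 ≤ n) :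
    ¬ n ∣ 1 * 1 * C := by
  intro h
  simp only [Finset.mem_insert, Finset.mem_singleton] at hC
  have h36 : n ∣ 36 := by
    rcases hC with rfl | rfl | rfl | rfl <;> exact (by simpa using h : n ∣ _).trans (by norm_num)
  have hle : n ≤ 36 := Nat.le_of_dvd (by norm_num) h36
  interval_cases n <;> revert hn h36 <;> decide

/-- Small facts about the row coefficients: `0 < C`, `2 ∣ C`, `3 ∣ C`, `6 ≤ C`, and the level is `972`. [folklore] -/
theorem sh01_coeff (C : ℕ) (hC : C ∈ ({6, 12, 18, 36} : Finset ℕ)) :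
    0 < C ∧ 2 ∣ C ∧ 3 ∣ C ∧ 6 ≤ C ∧ bvy04Level .C3 1 1 C = 972 := by
  simp only [Finset.mem_insert, Finset.mem_singleton] at hC
  rcases hC with rfl | rfl | rfl | rfl <;> refine ⟨by norm_num, by norm_num, by norm_num, by norm_num, by decide⟩

/-- `|xy| > 1` is automatic: for `6 ≤ C` and `z ≠ 0`, `C z³ ∉ {0, 2, −2}`. [folklore] -/
theorem sh01_not_small (C : ℕ) (hC6 : 6 ≤ C) (z : ℤ) (hz : z ≠ 0) (s : ℤ) (hs : s = 0 ∨ s = 2 ∨ s = -2) :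
    s ≠ (C : ℤ) * z ^ 3 := by
  intro h
  have habs : s.natAbs = C * z.natAbs ^ 3 := by
    rw [h, Int.natAbs_mul, Int.natAbs_pow]
    simp
  have hz1 : 1 ≤ z.natAbs := Nat.one_le_iff_ne_zero.mpr (Int.natAbs_ne_zero.mpr hz)
  have hz3 : 1 ≤ z.natAbs ^ 3 := Nat.one_le_pow _ _ hz1
  have h6 : 6 ≤ C * z.natAbs ^ 3 := by
    have := Nat.mul_le_mul hC6 hz3
    simpa using this
  rcases hs with rfl | rfl | rfl <;> simp at habs <;> omega

/-- From a primitive solution of the row: `x y ≠ ±1` (print's `ab ≠ ±1`). [folklore] -/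
theorem sh01_xy_ne (C n : ℕ) (hC6 : 6 ≤ C) (hn : Odd n) (x y z : ℤ) (h : IsPrimitiveSolution 1 1 C n x y z) :
    x * y ≠ 1 ∧ x * y ≠ -1 := by
  obtain ⟨heq, -, -, hz, -, -, -⟩ := h
  simp only [Nat.cast_one, one_mul] at heq
  have hz' : z ≠ 0 := by
    rintro rfl
    exact hz (by simp)
  constructor
  · intro h1
    rcases Int.eq_one_or_neg_one_of_mul_eq_one' h1 with ⟨rfl, rfl⟩ | ⟨rfl, rfl⟩
    · exact sh01_not_small C hC6 z hz' 2 (by norm_num) (by simpa using heq)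
    · exact sh01_not_small C hC6 z hz' (-2) (by norm_num) (by rw [← heq, hn.neg_one_pow]; norm_num)
  · intro h1
    rcases Int.eq_one_or_neg_one_of_mul_eq_neg_one' h1 with ⟨rfl, rfl⟩ | ⟨rfl, rfl⟩
    · exact sh01_not_small C hC6 z hz' 0 (by norm_num) (by rw [← heq, hn.neg_one_pow]; norm_num)
    · exact sh01_not_small C hC6 z hz' 0 (by norm_num) (by rw [← heq, hn.neg_one_pow]; norm_num)

/-- `3 ∤ x` and `3 ∤ y` for a primitive solution of the row (`3 ∣ C`, `(x, Cz) = (y, Cz) = 1`). [folklore] -/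
theorem sh01_three_not_dvd (C n : ℕ) (hC3 : 3 ∣ C) (x y z : ℤ) (h : IsPrimitiveSolution 1 1 C n x y z) :
    ¬ (3 : ℤ) ∣ x ∧ ¬ (3 : ℤ) ∣ y := by
  obtain ⟨-, -, -, -, -, hxz, hyz⟩ := h
  simp only [Nat.cast_one, one_mul] at hxz hyz
  have hCz : (3 : ℤ) ∣ (C : ℤ) * z := Dvd.dvd.mul_right (Int.natCast_dvd_natCast.mpr hC3) z
  have key : ∀ w : ℤ, IsCoprime w ((C : ℤ) * z) → ¬ (3 : ℤ) ∣ w := by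
    intro w hw h3
    have hu : IsUnit (3 : ℤ) := hw.isUnit_of_dvd' h3 hCz
    rcases Int.isUnit_iff.mp hu with h | h <;> norm_num at h
  exact ⟨key x hxz, key y hyz⟩

/-- **Core of the row** (normalised solutions): under the named hypotheses, a primitive solution of `xⁿ + yⁿ = C z³`
(`C ∈ {6,12,18,36}`, prime `n ≥ 5`) in print's normal form `yⁿ ≢ 2 (mod 3)` is impossible. The CASE TREE: [L.3.4 + Cor 3.3]
give a newform `f` of level 972 with [Prop 4.2] congruences; `DataComplete` puts `f` in one of the seven orbits; the three
non-CM orbits are killed by the kernel sieve certificates (`Level972.lean`), the four CM orbits by [Prop 4.3] with (a) void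
(`2 ∣ C`), (b) at `n = 5` by inertness of 5 in `ℚ(√−3)`, at `n = 7, 13` by the rank inputs, the `3^s`-alternative by `3 ∤ xy`.
[cite: BennettVatsalYazdani2004, Lemma 3.4, Props 4.2-4.3, p.1407] -/
theorem sh01_core (M : CMNewformModel) (hP : M.BVY04Package) (h43 : M.BVY04Prop43)
    (hJ21 : M.BVY04RankInput21) (hJ39 : M.BVY04RankInput39)
    (hD : M.DataComplete 972 level972Orbits) (hCM : M.CMBy 972 level972CMOrbits (-3))
    (C : ℕ) (hC : C ∈ ({6, 12, 18, 36} : Finset ℕ)) (n : ℕ) (hn : n.Prime) (h5 : 5 ≤ n)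
    (x y z : ℤ) (hsol : IsPrimitiveSolution 1 1 C n x y z) (hnorm : ¬ (3 : ℤ) ∣ y ^ n - 2) : False := by
  obtain ⟨hC0, hC2, hC3, hC6, hlevel⟩ := sh01_coeff C hC
  have hodd : Odd n := hn.odd_of_ne_two (by omega)
  obtain ⟨hxy1, hxy2⟩ := sh01_xy_ne C n hC6 hodd x y z hsol
  obtain ⟨h3x, h3y⟩ := sh01_three_not_dvd C n hC3 x y z hsol
  let S : FreyDatum := ⟨1, 1, C, n, x, y, z⟩
  have hpk := hP S .C3 Nat.one_pos Nat.one_pos hC0 (sh01_cubefree C hC)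
    (fun q hq => ⟨fun h => hq.one_lt.ne' (Nat.eq_one_of_dvd_one ((dvd_pow_self q hn.ne_zero).trans h)),
      fun h => hq.one_lt.ne' (Nat.eq_one_of_dvd_one ((dvd_pow_self q hn.ne_zero).trans h))⟩)
    hn h5 (sh01_n_not_dvd C hC n hn h5) (show ¬ (3 : ℤ) ∣ ((1 : ℕ) : ℤ) * x by simpa using h3x)
    (show ¬ (3 : ℤ) ∣ ((1 : ℕ) : ℤ) * y ^ n - 2 by simpa using hnorm) hsol hxy1 hxy2
    (show ¬ (1 * 1 = 27 ∧ n = 5) by norm_num) (show ¬ (1 * 1 = 3 ∧ n = 7) by norm_num)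
    (show 3 ∣ C from hC3) 972 hlevel
  obtain ⟨⟨f, hf⟩, hmod⟩ := hpk
  have hmodB : M.ArisesMod f n bvy04Allowed :=
    arisesMod_mono M.toNewformModel f n bvy04AllowedPrint bvy04Allowed bvy04AllowedPrint_subset (hmod f hf)
  obtain ⟨o, ho, hfo⟩ := hD f
  have hgood := level972_wellformed o ho
  rw [mem_level972Orbits] at ho
  rcases ho with hoCM | rfl | rfl | rfl
  · -- the four CM orbits: [BVY04, Prop 4.3] case tree
    have hcm : M.HasCM 972 f (-3) := hCM f o hoCM hfo
    have hsq : Squarefree (-3 : ℤ) := by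
      rw [← Int.squarefree_natAbs]
      exact Nat.prime_three.squarefree
    rcases h43 S 972 f (-3) Nat.one_pos Nat.one_pos hC0 (sh01_cubefree C hC)
      (fun q hq => ⟨fun h => hq.one_lt.ne' (Nat.eq_one_of_dvd_one ((dvd_pow_self q hn.ne_zero).trans h)),
        fun h => hq.one_lt.ne' (Nat.eq_one_of_dvd_one ((dvd_pow_self q hn.ne_zero).trans h))⟩)
      hn h5 (show ¬ (3 : ℤ) ∣ ((1 : ℕ) : ℤ) * x by simpa using h3x)
      (show ¬ (3 : ℤ) ∣ ((1 : ℕ) : ℤ) * y ^ n - 2 by simpa using hnorm) hsol hxy1 hxy2 hf (by norm_num) hsq hcm with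
      ⟨-, h2, -⟩ | ⟨hn513, hsplit, halt⟩
    · exact h2 (show 2 ∣ 1 * 1 * C by simpa using hC2)
    · rcases hn513 with hn5 | hn7 | hn13
      · -- `n = 5` is inert in `ℚ(√−3)`
        have hn5' : S.n = 5 := hn5
        rw [hn5'] at hsplit
        simp only [QuadSplits, show (5 : ℕ) ≠ 2 by decide, if_false] at hsplit
        obtain ⟨-, x5, hx5⟩ := hsplit
        revert x5 hx5
        decide
      · rcases halt with hJ | ⟨⟨r, s, hs, hrs⟩, -⟩
        · have hn7' : S.n = 7 := hn7
          rw [hn7'] at hJ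
          exact hJ hJ21
        · have h3xy : (3 : ℤ) ∣ x * y := by
            have h3 : (3 : ℤ) ∣ 2 ^ r * 3 ^ s := Dvd.dvd.mul_left (dvd_pow_self 3 hs.ne') _
            rcases hrs with h | h
            · exact (show S.a * S.b = x * y from rfl) ▸ h ▸ h3
            · exact (show S.a * S.b = x * y from rfl) ▸ h ▸ h3.neg_right
          rcases Int.prime_three.dvd_or_dvd h3xy with h | h
          · exact h3x h
          · exact h3y h
      · rcases halt with hJ | ⟨⟨r, s, hs, hrs⟩, -⟩
        · have hn13' : S.n = 13 := hn13
          rw [hn13'] at hJ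
          exact hJ hJ39
        · have h3xy : (3 : ℤ) ∣ x * y := by
            have h3 : (3 : ℤ) ∣ 2 ^ r * 3 ^ s := Dvd.dvd.mul_left (dvd_pow_self 3 hs.ne') _
            rcases hrs with h | h
            · exact (show S.a * S.b = x * y from rfl) ▸ h ▸ h3
            · exact (show S.a * S.b = x * y from rfl) ▸ h ▸ h3.neg_right
          rcases Int.prime_three.dvd_or_dvd h3xy with h | h
          · exact h3x h
          · exact h3y h
  · exact M.not_arisesMod_of_eliminated f orbit_972_5 hfo n bvy04Allowed
      ((level972_nonCM_eliminated n hn h5).1) hgood hmodB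
  · exact M.not_arisesMod_of_eliminated f orbit_972_6 hfo n bvy04Allowed
      ((level972_nonCM_eliminated n hn h5).2.1) hgood hmodB
  · exact M.not_arisesMod_of_eliminated f orbit_972_7 hfo n bvy04Allowed
      ((level972_nonCM_eliminated n hn h5).2.2) hgood hmodB

/-- **Row SH-01 (reduction theorem).** Under the named hypotheses (module docstring) — the cited [BVY04] print package
and Prop 4.3, the two printed rank inputs of [BVY04, p. 1407], the COMPUTED newform data of level 972 (`DataComplete`)
and its CM certification (`CMBy`) — `xⁿ + yⁿ = C z³` has no non-trivial primitive solution for any `C ∈ {6, 12, 18, 36}`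
and any prime `n ≥ 5`, i.e. `SH01`. The symmetry `x ↔ y` supplies print's normalisation `yⁿ ≢ 2 (mod 3)`.
ADJACENT, NOT abc. [cite: Krawciow2011, Thm 1.1 (sharpened to every prime n ≥ 5, conditionally on the named inputs)] -/
theorem sh01_of (M : CMNewformModel) (hP : M.BVY04Package) (h43 : M.BVY04Prop43)
    (hJ21 : M.BVY04RankInput21) (hJ39 : M.BVY04RankInput39)
    (hD : M.DataComplete 972 level972Orbits) (hCM : M.CMBy 972 level972CMOrbits (-3)) : SH01 := by
  intro C hC n hn h5
  obtain ⟨hC0, -, hC3, -, -⟩ := sh01_coeff C hC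
  rw [noPrimitiveSolution_iff C n hC0.ne']
  intro x y z hsol
  by_cases hnorm : (3 : ℤ) ∣ y ^ n - 2
  · -- swap `x ↔ y`: then `xⁿ ≡ −yⁿ ≡ −2 ≡ 1 (mod 3)`, so `xⁿ ≢ 2 (mod 3)`
    have hsol' : IsPrimitiveSolution 1 1 C n y x z := by
      obtain ⟨heq, hx, hy, hz, hxy, hxz, hyz⟩ := hsol
      exact ⟨by rw [← heq]; ring, hy, hx, hz, hxy.symm, hyz, hxz⟩
    refine sh01_core M hP h43 hJ21 hJ39 hD hCM C hC n hn h5 y x z hsol' ?_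
    obtain ⟨heq, -, -, -, -, -, -⟩ := hsol
    simp only [Nat.cast_one, one_mul] at heq
    have hCz : (3 : ℤ) ∣ (C : ℤ) * z ^ 3 := Dvd.dvd.mul_right (Int.natCast_dvd_natCast.mpr hC3) _
    obtain ⟨k, hk⟩ := hnorm
    obtain ⟨m, hm⟩ := hCz
    omega
  · exact sh01_core M hP h43 hJ21 hJ39 hD hCM C hC n hn h5 x y z hsol hnorm

/-- **Bridge shape** (as `AbcSig/Rows/Bridge.lean` does for its census predicates): the same row in the print convention
`IsPrimitiveSolution 1 1 C n x y z` ("`x, y, Cz` nonzero and pairwise coprime"), for each `C ∈ {6, 12, 18, 36}` and prime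
`n ≥ 5`. [cite: Krawciow2011, Thm 1.1 (sharpened to every prime n ≥ 5, conditionally on the named inputs)] -/
theorem sh01_no_isPrimitiveSolution_of (M : CMNewformModel) (hP : M.BVY04Package) (h43 : M.BVY04Prop43)
    (hJ21 : M.BVY04RankInput21) (hJ39 : M.BVY04RankInput39)
    (hD : M.DataComplete 972 level972Orbits) (hCM : M.CMBy 972 level972CMOrbits (-3))
    (C : ℕ) (hC : C ∈ ({6, 12, 18, 36} : Finset ℕ)) (n : ℕ) (hn : n.Prime) (h5 : 5 ≤ n) (x y z : ℤ) :
    ¬ IsPrimitiveSolution 1 1 C n x y z :=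
  (noPrimitiveSolution_iff C n (sh01_coeff C hC).1.ne').mp (sh01_of M hP h43 hJ21 hJ39 hD hCM C hC n hn h5) x y z

end Summit.Ventures.AbcShadow
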